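import Literature.AlgebraicGeometry.Motives.SeesawGrauertAffineCech
import Literature.AlgebraicGeometry.Motives.CechComplexPseudoCoherentDescent
import HarnessLib

/-!
# The seesaw theorem over a field from the single leaf of the directory: composite reductions
# (Görtz–Wedhorn II, Thm. 24.66 from Thm. 23.140 (3), Cor. 23.135 and Thm. 23.133)

`Motives/SeesawCohomologyBaseChange` proves the Seesaw Theorem over a field (Görtz–Wedhorn II,
Thm. 24.66: on `X ×_K T`, `X → Spec K` proper geometrically integral, `T` an integral `K`-scheme, a
divisor class trivial on every fibre `X_t` is `pr_T^*` of a class on `T`) for one family `(X, T, D)`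
from cohomology and base change in degree `0` for `𝒪(D)` taken as an explicit hypothesis
(`exists_linEquiv_classPullback_snd_of_forall_exists_isSectionOver`), and `Motives/SeesawGrauert`
supplies that hypothesis from the Grothendieck complex of `𝒪(D)` (the named fact
`grothendieckComplex_sectionsOver`, Thm. 23.133 / Cor. 23.135 in degree `0`), whence
`seesaw_exists_linEquiv_classPullback_of_grothendieckComplex_sectionsOver`. The printed proof of the
remaining input (Thm. 23.133: `Rf_*𝓕` is perfect and commutes with base change) is meanwhile a
chain of PROVED implications of this directory ending in one unproved statement; this sibling file
records the composite implications as single theorems, so that the discharges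
`grothendieckComplex_sectionsOver_holds` and `seesaw_exists_linEquiv_classPullback_holds` are
one-liners the moment the leaf lands:

* `grothendieckComplex_sectionsOver_of_finite_cohomology` — **Grauert's theorem in degree `0` for
  `𝒪(D)` (`grothendieckComplex_sectionsOver`) from the finiteness of the Čech cohomology modules
  `Hⁿ(Č•(𝔚, 𝒪(D)))` over affine integral bases of finite type over `K`**, i.e. from the finiteness
  theorem for the coherent cohomology of the proper `X ×_K T₀ → T₀` over a noetherian base
  (Thm. 23.17 / Cor. 23.18; EGA III 3.2.1) in Čech form: Step (IV) of the proof of Thm. 23.133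
  (noetherian approximation, `cechComplex_pseudoCoherent_general_of_finite_cohomology` of
  `Motives/CechComplexPseudoCoherentDescent`), Steps (II)–(III) (`cechComplex_perfect_of_general` of
  `Motives/GrothendieckComplexSectionAlongCech`, perfectness of the ordered Čech complex over affine
  opens of the base), then Mumford's Lemma 2, localization to basic opens and gluing
  (`grothendieckComplex_sectionsOver_of_perfect`, `Motives/SeesawGrauertAffineCech`);
* `seesaw_exists_linEquiv_classPullback_of_finite_cohomology` — **the Seesaw Theorem
  `seesaw_exists_linEquiv_classPullback` from the same finiteness hypothesis**, through the previous
  theorem and `seesaw_exists_linEquiv_classPullback_of_grothendieckComplex_sectionsOver`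
  (Prop. 23.128 in degree `0`, Cor. 24.63, Lemma 24.67 and the argument of p. 546, all proved);
* `seesaw_isClosed_trivialLocus_of_finite_cohomology` — likewise the closedness half
  `seesaw_isClosed_trivialLocus` (Thm. 24.66 (3): semicontinuity, Thm. 23.139 (2), and Lemma 24.65,
  `seesaw_isClosed_trivialLocus_of_grothendieckComplex_sectionsOver`).

This finiteness hypothesis — Chow's lemma and dévissage on coherent modules for a proper, possibly
non-projective `X`, or Serre's theorem for a projective one — is all that separates the seesaw
theorem over a field from a theorem of this tree.

**History (D-0026 review of a decomposition, 2026-08-15).** `Motives/SeesawCohomologyBaseChange`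
used to package its hypothesis as a named fact `cohomologyBaseChange_exists_isSectionOver`
(Thm. 23.140 (3) in degree `0` for `𝒪(D)` on `X ×_K T → T`), and the first revision of this file
recorded the composites `cohomologyBaseChange_exists_isSectionOver_of_perfect`,
`…_of_pseudoCoherent_general`, `…_of_finite_cohomology` ending in it. That fact was provably
*equivalent* to the seesaw statement it served and already implied by
`grothendieckComplex_sectionsOver` — a pure pass-through —, so it was merged back: the composites
now end in `grothendieckComplex_sectionsOver` and in the two seesaw facts of `Motives/SeesawTheorem`
directly. Everything here is proved; no named facts. Mathlib (pin) has no coherent cohomology of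
proper morphisms; searched the tree: `grothendieckComplex_sectionsOver_of_` (`…_of_perfect`,
`…_of_pseudoCoherent`, `…_of_pseudoCoherent_general`, `…_of_basicOpen`),
`seesaw_exists_linEquiv_classPullback_of_` (`…_of_grothendieckComplex_sectionsOver`,
`…_of_pseudoCoherent_general`), `cechComplex_pseudoCoherent_general_holds` (absent).

## References

* U. Görtz, T. Wedhorn, *Algebraic Geometry II: Cohomology of Schemes*, Springer Spektrum (2023),
  doi:10.1007/978-3-658-43031-3: Thm. 23.17, Cor. 23.18, p. 444; Prop. 23.128, p. 474; Thm. 23.133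
  and its proof, Steps (I)–(IV), Rem. 23.134, Cor. 23.135, Cor. 23.137, pp. 478–480;
  (23.28.5)–(23.28.6), Thm. 23.139, Thm. 23.140 (3) and its proof, pp. 482–483; Lemma 24.65,
  Thm. 24.66 and its proof, pp. 542–546 (read via the held copy). [GortzWedhorn2023]
* D. Mumford, *Abelian Varieties*, TIFR Studies in Mathematics 5 (1970), §5 (the Grothendieck
  complex; cohomology and base change; the seesaw theorem). [MumfordAV1970]
-/

universe u

open CategoryTheory CategoryTheory.Limits AlgebraicGeometry MonoidalCategory
open CartesianMonoidalCategory

namespace Literature.AlgebraicGeometry.Motives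

/-- **Grauert's theorem in degree `0` for `𝒪(D)` on `X ×_K T → T` (`grothendieckComplex_sectionsOver`,
Görtz–Wedhorn II, Thm. 23.133 / Cor. 23.135 with Thm. 23.140 (3)) from the finiteness of Čech
cohomology over a noetherian base**: if for every field `K`, every proper `X → Spec K`, every affine
integral `K`-scheme `T` of finite type (`Γ(T, 𝒪)` noetherian) with `X ×_K T` integral, every
Cartier divisor `D` on `X ×_K T` and every Čech cover `𝔚` of `X ×_K T` over `T` adapted to `D`, the
cohomology modules of `Č•(𝔚, 𝒪(D))` are finitely generated over `Γ(T, 𝒪)` (the finiteness theorem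
for the coherent cohomology of proper morphisms, Thm. 23.17 / Cor. 23.18, EGA III 3.2.1, in Čech
form), then `grothendieckComplex_sectionsOver` holds — by Step (IV) of the proof of Thm. 23.133
(`cechComplex_pseudoCoherent_general_of_finite_cohomology`), Steps (II)–(III)
(`cechComplex_perfect_of_general`) and `grothendieckComplex_sectionsOver_of_perfect`, all proved.
The discharge `grothendieckComplex_sectionsOver_holds` is this theorem applied to the finiteness
theorem once it lands.
[cite: GortzWedhorn2023, Thm. 23.133, proof, Steps (I)–(IV) and Cor. 23.135 (pp. 478–480), with Thm. 23.17 (p. 444)] -/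
theorem grothendieckComplex_sectionsOver_of_finite_cohomology
    (h : ∀ (K : Type u) [Field K] (X T : SchemeOver K) [IsProper X.hom] [IsAffine T.left]
      [IsIntegral T.left] [LocallyOfFiniteType T.hom] [IsNoetherianRing Γ(T.left, ⊤)]
      [IsIntegral (X ⊗ T).left] (D : CartierDivisor (X ⊗ T).left)
      (𝔚 : CartierDivisor.CechCover (snd X T).left ⊤ D) (n : ℤ),
      Module.Finite Γ(T.left, ⊤) (𝔚.complex.homology n)) :
    grothendieckComplex_sectionsOver.{u} :=
  grothendieckComplex_sectionsOver_of_perfect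
    (cechComplex_perfect_of_general (cechComplex_pseudoCoherent_general_of_finite_cohomology h))

/-- **The seesaw theorem over a field (`seesaw_exists_linEquiv_classPullback`, Görtz–Wedhorn II,
Thm. 24.66) from the finiteness of Čech cohomology over a noetherian base**, through
`grothendieckComplex_sectionsOver_of_finite_cohomology` and
`seesaw_exists_linEquiv_classPullback_of_grothendieckComplex_sectionsOver` (Prop. 23.128 in degree
`0`, Cor. 24.63, Lemma 24.67, proof of Thm. 24.66 (2), all proved in `Motives/SeesawGrauert` and
`Motives/SeesawCohomologyBaseChange`). [cite: GortzWedhorn2023, Thm. 24.66, proof (pp. 544–546)] -/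
theorem seesaw_exists_linEquiv_classPullback_of_finite_cohomology
    (h : ∀ (K : Type u) [Field K] (X T : SchemeOver K) [IsProper X.hom] [IsAffine T.left]
      [IsIntegral T.left] [LocallyOfFiniteType T.hom] [IsNoetherianRing Γ(T.left, ⊤)]
      [IsIntegral (X ⊗ T).left] (D : CartierDivisor (X ⊗ T).left)
      (𝔚 : CartierDivisor.CechCover (snd X T).left ⊤ D) (n : ℤ),
      Module.Finite Γ(T.left, ⊤) (𝔚.complex.homology n)) :
    seesaw_exists_linEquiv_classPullback.{u} :=
  seesaw_exists_linEquiv_classPullback_of_grothendieckComplex_sectionsOver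
    (grothendieckComplex_sectionsOver_of_finite_cohomology h)

/-- **The seesaw theorem, closedness of the trivial locus (`seesaw_isClosed_trivialLocus`,
Görtz–Wedhorn II, Thm. 24.66 (3)) from the finiteness of Čech cohomology over a noetherian base**,
through `grothendieckComplex_sectionsOver_of_finite_cohomology` and
`seesaw_isClosed_trivialLocus_of_grothendieckComplex_sectionsOver` (its fibre clause, semicontinuity
Thm. 23.139 (2) and Lemma 24.65, all proved).
[cite: GortzWedhorn2023, Thm. 24.66 (3), proof (pp. 545–546)] -/
theorem seesaw_isClosed_trivialLocus_of_finite_cohomology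
    (h : ∀ (K : Type u) [Field K] (X T : SchemeOver K) [IsProper X.hom] [IsAffine T.left]
      [IsIntegral T.left] [LocallyOfFiniteType T.hom] [IsNoetherianRing Γ(T.left, ⊤)]
      [IsIntegral (X ⊗ T).left] (D : CartierDivisor (X ⊗ T).left)
      (𝔚 : CartierDivisor.CechCover (snd X T).left ⊤ D) (n : ℤ),
      Module.Finite Γ(T.left, ⊤) (𝔚.complex.homology n)) :
    seesaw_isClosed_trivialLocus.{u} :=
  seesaw_isClosed_trivialLocus_of_grothendieckComplex_sectionsOver
    (grothendieckComplex_sectionsOver_of_finite_cohomology h)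

end Literature.AlgebraicGeometry.Motives
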